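import Summits.BirchSwinnertonDyer.BirchSwinnertonDyer.Theorems.Rank2ObservatoryRank3PSatCertK
import Summits.BirchSwinnertonDyer.BirchSwinnertonDyer.Theorems.Rank2ObservatoryRank3Rows01
import Summits.BirchSwinnertonDyer.BirchSwinnertonDyer.Theorems.Rank2ObservatoryRank3Rows02
import Summits.BirchSwinnertonDyer.BirchSwinnertonDyer.Theorems.Rank2ObservatoryRank3Rows03
import Summits.BirchSwinnertonDyer.BirchSwinnertonDyer.Theorems.Rank2ObservatoryRank3Rows04
import Summits.BirchSwinnertonDyer.BirchSwinnertonDyer.Theorems.Rank2ObservatoryRank3Rows05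
import Summits.BirchSwinnertonDyer.BirchSwinnertonDyer.Theorems.Rank2ObservatoryRank3Rows06
import Summits.BirchSwinnertonDyer.BirchSwinnertonDyer.Theorems.Rank2ObservatoryRank3Rows07
import Summits.BirchSwinnertonDyer.BirchSwinnertonDyer.Theorems.Rank2ObservatoryRank3PSat357Census
import Summits.BirchSwinnertonDyer.BirchSwinnertonDyer.Theorems.Rank2ObservatoryRank3PSatM31JoinA
import HarnessLib

/-!
# BirchSwinnertonDyer — rank ≥ 2 observatory: S10-CPS census (J11c), chunks 01–07: GENERATORS

HONEST FRAMING: per-curve certified theorems and census instruments; no claim on BSD in rank ≥ 2.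

THE CPS-BOUND SEARCH CENSUS, chunks 01–07 (54 rows of these chunks; 396 of the 9 487 GRAND rank-3
rows in all — rows of the residual 396 of the generators union census
`GeneratorsCensus.census_total`, i.e. rows whose Silverman-constant search bound exceeded every
earlier register). Register J11c replaces Silverman's height-difference constant by the
Cremona–Prickett–Siksek bound [CremonaPrickettSiksek2006, Thm 1 with Table 1 and Lemmas 9–10: on the
global minimal model, `h(P) − ĥ(P) ≤ (1/3) log ε_∞ + Σ_p α_p log p`, `h(P) = log max(|num x|, den
x)`, `ĥ` in the PARI / BSD normalisation `lim h(2ⁿP)/4ⁿ`] computed by TWO implementations that AGREE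
on every listed row (identical (p, Kodaira symbol, c_p) at every bad prime and |B_A − B_B| ≤ 10⁻⁶;
the register uses max(B_A, B_B) + 0.01): implementation A = PARI `elllocalred` + `polrootsreal`
(kit), cell implementation B = exact rational Sturm arithmetic for the real place + a PARI-free Tate
algorithm (validated against the paper's Examples 3–4 to 10⁻⁹). Both implementations then enumerate
ALL points of naive height `max(|num x|, den x) ≤ H` (A: PARI `ellratpoints` + `ellorder` +
`ellheight`; B: the engine of record `ecpointsieve` 0.1.0, engines MANIFEST 0c2f6b8785a885b8, exact
torsion and exact-doubling height brackets) and AGREE (point count, non-torsion count, A's minimal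
height inside B's bracket, the listed generators found). The datum `m` is: LEVER H — Hermite (`γ₃³ =
2`) with `λ₁ ≥ min(log(H+1) − B, min ĥ found)`, `index ≤ m = ⌊√(2·Reg_hi/λ₁³)⌋ ≤ 10`, the larger of
the two implementations' values; LEVER S (rows whose `λ₁` is fixed by an actual small point,
recorded with `m = 1`) — saturation by exhaustive search [Siksek, Rocky Mountain J. Math. 25 (1995);
CremonaAlgorithms1997 §3.5]: with `Λ* = ¼·max_± ĥ(P₁ ± P₂ ± P₃)` and `log(H+1) > Λ* + B`, every
point of `E(ℚ)` with `ĥ ≤ Λ*` is enumerated, and BOTH implementations decide EXACTLY (integer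
coefficients, exact group law, exact torsion test) that each of them lies in `ℤP₁ + ℤP₂ + ℤP₃ +
E(ℚ)_tors`; since a proper finite-index sublattice of full rank leaves a coset representative of
height `≤ Λ*` outside, the index is 1 (the rank `= 3` of the row is the recorded rank,
kernel-certified for the rows of `Rank3KernelRankCensusN9375`). As in the landed S10 files the
number `m` is instrument DATA: it enters ONLY as the hypothesis `index ≤ m` of `generatorsNN` and as
the (EMPTY: no prime `7 < p ≤ m ≤ 10`) range of the saturation certificate list, checked by the
landed selection Boolean `rank3PSatCheckKSel` by kernel `decide` (`pSatCheckK_NN`), exported by the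
landed soundness theorem `Rank3Row.pSaturated_of_pSatCheckKSel_idx` (`coverNN`), and JOINED
(`generatorsNN`) with the KS3 census `PSatCensus357.index_coprime_210_of_mem_rows` exactly as in
`PSatCensusS10`: under the ONE named numeric hypothesis `index ≤ m` the listed points and the
torsion GENERATE. No definitions; no new lemmas. Register (instrument data, kit job j342025, tag
bsd-r1): cell `code/b2b-bsdr2-cert-2/sat2-r3/g46/j11c/prod-j342025/` — `register-J11c.tsv` sha256
d829e0e83d7ddbf6…, `j11c.jsonl` sha256 82254102cac8b632…, SHA256SUMS, README-J11c.md (method, the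
LEVER S argument, referee spot-check kit).

References: Cremona–Prickett–Siksek, J. Number Theory 116 (2006) 42–68, Thm 1, Table 1, Lemmas 9–10
[CremonaPrickettSiksek2006]; Siksek, Rocky Mountain J. Math. 25 (1995) 1501–1538, §3; Cremona,
*Algorithms for Modular Elliptic Curves* (1997) §3.5 [CremonaAlgorithms1997]; Silverman,
*The Arithmetic of Elliptic Curves* (2009) VIII.6.7.
-/

-- single-conjunct summit: `Summit.BirchSwinnertonDyer.BirchSwinnertonDyer.…` repeats the name
set_option linter.dupNamespace false

namespace Summit.BirchSwinnertonDyer.BirchSwinnertonDyer.Rank2Observatory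

namespace PSatCensusS10CPS

open Rank3KernelRankCensusN9365 (rows mem_rank3Table rank_eq_three)
open PSatCensusM31 (eq_one_of_forall_prime_le_not_dvd not_dvd_of_prime_le_seven)

/-- **Chunk 01, register J11c** (2 rows, two-implementation CPS-bound datum `m ≤ 10`): kernel check
of the selection `(position, m, [])` — every listed row exists in `rank3Rows01` and no prime
`7 < p ≤ m` is left uncertified (there is none). [cite: CremonaPrickettSiksek2006, Thm 1] -/
theorem pSatCheckK_01 :
    rank3PSatCheckKSel rank3Rows01 [
    (178, 1, []), (274, 1, [])] = true := by
  decide +kernel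

set_option maxRecDepth 8000 in
/-- **Chunk 01: cover** — for every listed `(i, m)` the row `rank3Rows01[i]` exists and its listed
span is `p`-saturated for every prime `7 < p ≤ m` (vacuous range; generic soundness of the selection
form). [cite: CremonaAlgorithms1997, §3.5] -/
theorem cover01 :
    ∀ e ∈ ([
      (178, 1), (274, 1)] : List (ℕ × ℕ)),
      ∃ r, rank3Rows01[e.1]? = some r ∧ ∀ p, p.Prime → 7 < p → p ≤ e.2 →
        ∀ h : r.check = true, ∀ a : r.curve.toAffine.Point,
          p • a ∈ AddSubgroup.closure {r.gen₁ h, r.gen₂ h, r.gen₃ h} ⊔ AddCommGroup.torsion _ →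
            a ∈ AddSubgroup.closure {r.gen₁ h, r.gen₂ h, r.gen₃ h} ⊔ AddCommGroup.torsion _ :=
  Rank3Row.pSaturated_of_pSatCheckKSel_idx (by rfl) pSatCheckK_01

/-- **GENERATORS under ONE named numeric hypothesis, chunk 01** (2 rows, register J11c
`m ≤ 10`; `m = 1` rows = LEVER S, saturation by exhaustive search): for every listed `(i, m)`, if
`rank3Rows01[i]` is a GRAND row and the index of its listed span is `≤ m` (instrument DATA, two
implementations agree), then `E(ℚ) = ℤP₁ + ℤP₂ + ℤP₃ + E(ℚ)_tors`.
[cite: CremonaPrickettSiksek2006, Thm 1] [cite: CremonaAlgorithms1997, §3.5] -/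
theorem generators01 :
    ∀ e ∈ ([
      (178, 1), (274, 1)] : List (ℕ × ℕ)),
      ∃ r, rank3Rows01[e.1]? = some r ∧ ∀ (hr : r ∈ rows) (h : r.check = true),
        (AddSubgroup.closure {r.gen₁ h, r.gen₂ h, r.gen₃ h} ⊔ AddCommGroup.torsion _).index ≤ e.2 →
          AddSubgroup.closure {r.gen₁ h, r.gen₂ h, r.gen₃ h} ⊔ AddCommGroup.torsion _ = ⊤ := by
  intro e he
  obtain ⟨r, hr', H⟩ := cover01 e he
  refine ⟨r, hr', fun hr h hB => ?_⟩
  obtain ⟨hfi, h2, h3, h5, h7⟩ := PSatCensus357.index_coprime_210_of_mem_rows hr h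
  haveI := hfi
  refine AddSubgroup.index_eq_one.mp
    (eq_one_of_forall_prime_le_not_dvd AddSubgroup.FiniteIndex.index_ne_zero hB fun p hp hpB => ?_)
  by_cases h7p : 7 < p
  · exact not_dvd_index_listedSpan hp (H p hp h7p hpB h)
  · exact not_dvd_of_prime_le_seven h2 h3 h5 h7 hp h7p

/-- **Chunk 02, register J11c** (5 rows, two-implementation CPS-bound datum `m ≤ 10`): kernel check
of the selection `(position, m, [])` — every listed row exists in `rank3Rows02` and no prime
`7 < p ≤ m` is left uncertified (there is none). [cite: CremonaPrickettSiksek2006, Thm 1] -/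
theorem pSatCheckK_02 :
    rank3PSatCheckKSel rank3Rows02 [
    (9, 1, []), (71, 1, []), (90, 1, []), (113, 1, []), (297, 1, [])] = true := by
  decide +kernel

set_option maxRecDepth 8000 in
/-- **Chunk 02: cover** — for every listed `(i, m)` the row `rank3Rows02[i]` exists and its listed
span is `p`-saturated for every prime `7 < p ≤ m` (vacuous range; generic soundness of the selection
form). [cite: CremonaAlgorithms1997, §3.5] -/
theorem cover02 :
    ∀ e ∈ ([
      (9, 1), (71, 1), (90, 1), (113, 1), (297, 1)] : List (ℕ × ℕ)),
      ∃ r, rank3Rows02[e.1]? = some r ∧ ∀ p, p.Prime → 7 < p → p ≤ e.2 →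
        ∀ h : r.check = true, ∀ a : r.curve.toAffine.Point,
          p • a ∈ AddSubgroup.closure {r.gen₁ h, r.gen₂ h, r.gen₃ h} ⊔ AddCommGroup.torsion _ →
            a ∈ AddSubgroup.closure {r.gen₁ h, r.gen₂ h, r.gen₃ h} ⊔ AddCommGroup.torsion _ :=
  Rank3Row.pSaturated_of_pSatCheckKSel_idx (by rfl) pSatCheckK_02

/-- **GENERATORS under ONE named numeric hypothesis, chunk 02** (5 rows, register J11c
`m ≤ 10`; `m = 1` rows = LEVER S, saturation by exhaustive search): for every listed `(i, m)`, if
`rank3Rows02[i]` is a GRAND row and the index of its listed span is `≤ m` (instrument DATA, two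
implementations agree), then `E(ℚ) = ℤP₁ + ℤP₂ + ℤP₃ + E(ℚ)_tors`.
[cite: CremonaPrickettSiksek2006, Thm 1] [cite: CremonaAlgorithms1997, §3.5] -/
theorem generators02 :
    ∀ e ∈ ([
      (9, 1), (71, 1), (90, 1), (113, 1), (297, 1)] : List (ℕ × ℕ)),
      ∃ r, rank3Rows02[e.1]? = some r ∧ ∀ (hr : r ∈ rows) (h : r.check = true),
        (AddSubgroup.closure {r.gen₁ h, r.gen₂ h, r.gen₃ h} ⊔ AddCommGroup.torsion _).index ≤ e.2 →
          AddSubgroup.closure {r.gen₁ h, r.gen₂ h, r.gen₃ h} ⊔ AddCommGroup.torsion _ = ⊤ := by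
  intro e he
  obtain ⟨r, hr', H⟩ := cover02 e he
  refine ⟨r, hr', fun hr h hB => ?_⟩
  obtain ⟨hfi, h2, h3, h5, h7⟩ := PSatCensus357.index_coprime_210_of_mem_rows hr h
  haveI := hfi
  refine AddSubgroup.index_eq_one.mp
    (eq_one_of_forall_prime_le_not_dvd AddSubgroup.FiniteIndex.index_ne_zero hB fun p hp hpB => ?_)
  by_cases h7p : 7 < p
  · exact not_dvd_index_listedSpan hp (H p hp h7p hpB h)
  · exact not_dvd_of_prime_le_seven h2 h3 h5 h7 hp h7p

/-- **Chunk 03, register J11c** (4 rows, two-implementation CPS-bound datum `m ≤ 10`): kernel check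
of the selection `(position, m, [])` — every listed row exists in `rank3Rows03` and no prime
`7 < p ≤ m` is left uncertified (there is none). [cite: CremonaPrickettSiksek2006, Thm 1] -/
theorem pSatCheckK_03 :
    rank3PSatCheckKSel rank3Rows03 [
    (114, 1, []), (259, 1, []), (307, 1, []), (344, 2, [])] = true := by
  decide +kernel

set_option maxRecDepth 8000 in
/-- **Chunk 03: cover** — for every listed `(i, m)` the row `rank3Rows03[i]` exists and its listed
span is `p`-saturated for every prime `7 < p ≤ m` (vacuous range; generic soundness of the selection
form). [cite: CremonaAlgorithms1997, §3.5] -/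
theorem cover03 :
    ∀ e ∈ ([
      (114, 1), (259, 1), (307, 1), (344, 2)] : List (ℕ × ℕ)),
      ∃ r, rank3Rows03[e.1]? = some r ∧ ∀ p, p.Prime → 7 < p → p ≤ e.2 →
        ∀ h : r.check = true, ∀ a : r.curve.toAffine.Point,
          p • a ∈ AddSubgroup.closure {r.gen₁ h, r.gen₂ h, r.gen₃ h} ⊔ AddCommGroup.torsion _ →
            a ∈ AddSubgroup.closure {r.gen₁ h, r.gen₂ h, r.gen₃ h} ⊔ AddCommGroup.torsion _ :=
  Rank3Row.pSaturated_of_pSatCheckKSel_idx (by rfl) pSatCheckK_03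

/-- **GENERATORS under ONE named numeric hypothesis, chunk 03** (4 rows, register J11c
`m ≤ 10`; `m = 1` rows = LEVER S, saturation by exhaustive search): for every listed `(i, m)`, if
`rank3Rows03[i]` is a GRAND row and the index of its listed span is `≤ m` (instrument DATA, two
implementations agree), then `E(ℚ) = ℤP₁ + ℤP₂ + ℤP₃ + E(ℚ)_tors`.
[cite: CremonaPrickettSiksek2006, Thm 1] [cite: CremonaAlgorithms1997, §3.5] -/
theorem generators03 :
    ∀ e ∈ ([
      (114, 1), (259, 1), (307, 1), (344, 2)] : List (ℕ × ℕ)),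
      ∃ r, rank3Rows03[e.1]? = some r ∧ ∀ (hr : r ∈ rows) (h : r.check = true),
        (AddSubgroup.closure {r.gen₁ h, r.gen₂ h, r.gen₃ h} ⊔ AddCommGroup.torsion _).index ≤ e.2 →
          AddSubgroup.closure {r.gen₁ h, r.gen₂ h, r.gen₃ h} ⊔ AddCommGroup.torsion _ = ⊤ := by
  intro e he
  obtain ⟨r, hr', H⟩ := cover03 e he
  refine ⟨r, hr', fun hr h hB => ?_⟩
  obtain ⟨hfi, h2, h3, h5, h7⟩ := PSatCensus357.index_coprime_210_of_mem_rows hr h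
  haveI := hfi
  refine AddSubgroup.index_eq_one.mp
    (eq_one_of_forall_prime_le_not_dvd AddSubgroup.FiniteIndex.index_ne_zero hB fun p hp hpB => ?_)
  by_cases h7p : 7 < p
  · exact not_dvd_index_listedSpan hp (H p hp h7p hpB h)
  · exact not_dvd_of_prime_le_seven h2 h3 h5 h7 hp h7p

/-- **Chunk 04, register J11c** (8 rows, two-implementation CPS-bound datum `m ≤ 10`): kernel check
of the selection `(position, m, [])` — every listed row exists in `rank3Rows04` and no prime
`7 < p ≤ m` is left uncertified (there is none). [cite: CremonaPrickettSiksek2006, Thm 1] -/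
theorem pSatCheckK_04 :
    rank3PSatCheckKSel rank3Rows04 [
    (11, 1, []), (77, 1, []), (88, 1, []), (154, 1, []), (181, 1, []), (230, 1, []), (289, 1, []),
    (350, 1, [])] = true := by
  decide +kernel

set_option maxRecDepth 8000 in
/-- **Chunk 04: cover** — for every listed `(i, m)` the row `rank3Rows04[i]` exists and its listed
span is `p`-saturated for every prime `7 < p ≤ m` (vacuous range; generic soundness of the selection
form). [cite: CremonaAlgorithms1997, §3.5] -/
theorem cover04 :
    ∀ e ∈ ([
      (11, 1), (77, 1), (88, 1), (154, 1), (181, 1), (230, 1), (289, 1), (350, 1)] : List (ℕ × ℕ)),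
      ∃ r, rank3Rows04[e.1]? = some r ∧ ∀ p, p.Prime → 7 < p → p ≤ e.2 →
        ∀ h : r.check = true, ∀ a : r.curve.toAffine.Point,
          p • a ∈ AddSubgroup.closure {r.gen₁ h, r.gen₂ h, r.gen₃ h} ⊔ AddCommGroup.torsion _ →
            a ∈ AddSubgroup.closure {r.gen₁ h, r.gen₂ h, r.gen₃ h} ⊔ AddCommGroup.torsion _ :=
  Rank3Row.pSaturated_of_pSatCheckKSel_idx (by rfl) pSatCheckK_04

/-- **GENERATORS under ONE named numeric hypothesis, chunk 04** (8 rows, register J11c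
`m ≤ 10`; `m = 1` rows = LEVER S, saturation by exhaustive search): for every listed `(i, m)`, if
`rank3Rows04[i]` is a GRAND row and the index of its listed span is `≤ m` (instrument DATA, two
implementations agree), then `E(ℚ) = ℤP₁ + ℤP₂ + ℤP₃ + E(ℚ)_tors`.
[cite: CremonaPrickettSiksek2006, Thm 1] [cite: CremonaAlgorithms1997, §3.5] -/
theorem generators04 :
    ∀ e ∈ ([
      (11, 1), (77, 1), (88, 1), (154, 1), (181, 1), (230, 1), (289, 1), (350, 1)] : List (ℕ × ℕ)),
      ∃ r, rank3Rows04[e.1]? = some r ∧ ∀ (hr : r ∈ rows) (h : r.check = true),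
        (AddSubgroup.closure {r.gen₁ h, r.gen₂ h, r.gen₃ h} ⊔ AddCommGroup.torsion _).index ≤ e.2 →
          AddSubgroup.closure {r.gen₁ h, r.gen₂ h, r.gen₃ h} ⊔ AddCommGroup.torsion _ = ⊤ := by
  intro e he
  obtain ⟨r, hr', H⟩ := cover04 e he
  refine ⟨r, hr', fun hr h hB => ?_⟩
  obtain ⟨hfi, h2, h3, h5, h7⟩ := PSatCensus357.index_coprime_210_of_mem_rows hr h
  haveI := hfi
  refine AddSubgroup.index_eq_one.mp
    (eq_one_of_forall_prime_le_not_dvd AddSubgroup.FiniteIndex.index_ne_zero hB fun p hp hpB => ?_)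
  by_cases h7p : 7 < p
  · exact not_dvd_index_listedSpan hp (H p hp h7p hpB h)
  · exact not_dvd_of_prime_le_seven h2 h3 h5 h7 hp h7p

/-- **Chunk 05, register J11c** (9 rows, two-implementation CPS-bound datum `m ≤ 10`): kernel check
of the selection `(position, m, [])` — every listed row exists in `rank3Rows05` and no prime
`7 < p ≤ m` is left uncertified (there is none). [cite: CremonaPrickettSiksek2006, Thm 1] -/
theorem pSatCheckK_05 :
    rank3PSatCheckKSel rank3Rows05 [
    (110, 4, []), (121, 1, []), (159, 7, []), (217, 1, []), (236, 2, []), (237, 2, []),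
    (255, 1, []), (312, 2, []), (331, 1, [])] = true := by
  decide +kernel

set_option maxRecDepth 8000 in
/-- **Chunk 05: cover** — for every listed `(i, m)` the row `rank3Rows05[i]` exists and its listed
span is `p`-saturated for every prime `7 < p ≤ m` (vacuous range; generic soundness of the selection
form). [cite: CremonaAlgorithms1997, §3.5] -/
theorem cover05 :
    ∀ e ∈ ([
      (110, 4), (121, 1), (159, 7), (217, 1), (236, 2), (237, 2), (255, 1), (312, 2), (331,
      1)] : List (ℕ × ℕ)),
      ∃ r, rank3Rows05[e.1]? = some r ∧ ∀ p, p.Prime → 7 < p → p ≤ e.2 →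
        ∀ h : r.check = true, ∀ a : r.curve.toAffine.Point,
          p • a ∈ AddSubgroup.closure {r.gen₁ h, r.gen₂ h, r.gen₃ h} ⊔ AddCommGroup.torsion _ →
            a ∈ AddSubgroup.closure {r.gen₁ h, r.gen₂ h, r.gen₃ h} ⊔ AddCommGroup.torsion _ :=
  Rank3Row.pSaturated_of_pSatCheckKSel_idx (by rfl) pSatCheckK_05

/-- **GENERATORS under ONE named numeric hypothesis, chunk 05** (9 rows, register J11c
`m ≤ 10`; `m = 1` rows = LEVER S, saturation by exhaustive search): for every listed `(i, m)`, if
`rank3Rows05[i]` is a GRAND row and the index of its listed span is `≤ m` (instrument DATA, two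
implementations agree), then `E(ℚ) = ℤP₁ + ℤP₂ + ℤP₃ + E(ℚ)_tors`.
[cite: CremonaPrickettSiksek2006, Thm 1] [cite: CremonaAlgorithms1997, §3.5] -/
theorem generators05 :
    ∀ e ∈ ([
      (110, 4), (121, 1), (159, 7), (217, 1), (236, 2), (237, 2), (255, 1), (312, 2), (331,
      1)] : List (ℕ × ℕ)),
      ∃ r, rank3Rows05[e.1]? = some r ∧ ∀ (hr : r ∈ rows) (h : r.check = true),
        (AddSubgroup.closure {r.gen₁ h, r.gen₂ h, r.gen₃ h} ⊔ AddCommGroup.torsion _).index ≤ e.2 →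
          AddSubgroup.closure {r.gen₁ h, r.gen₂ h, r.gen₃ h} ⊔ AddCommGroup.torsion _ = ⊤ := by
  intro e he
  obtain ⟨r, hr', H⟩ := cover05 e he
  refine ⟨r, hr', fun hr h hB => ?_⟩
  obtain ⟨hfi, h2, h3, h5, h7⟩ := PSatCensus357.index_coprime_210_of_mem_rows hr h
  haveI := hfi
  refine AddSubgroup.index_eq_one.mp
    (eq_one_of_forall_prime_le_not_dvd AddSubgroup.FiniteIndex.index_ne_zero hB fun p hp hpB => ?_)
  by_cases h7p : 7 < p
  · exact not_dvd_index_listedSpan hp (H p hp h7p hpB h)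
  · exact not_dvd_of_prime_le_seven h2 h3 h5 h7 hp h7p

/-- **Chunk 06, register J11c** (11 rows, two-implementation CPS-bound datum `m ≤ 10`): kernel check
of the selection `(position, m, [])` — every listed row exists in `rank3Rows06` and no prime
`7 < p ≤ m` is left uncertified (there is none). [cite: CremonaPrickettSiksek2006, Thm 1] -/
theorem pSatCheckK_06 :
    rank3PSatCheckKSel rank3Rows06 [
    (44, 1, []), (64, 1, []), (76, 1, []), (79, 2, []), (84, 2, []), (89, 2, []), (150, 3, []),
    (168, 1, []), (182, 1, []), (295, 1, []), (335, 1, [])] = true := by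
  decide +kernel

set_option maxRecDepth 8000 in
/-- **Chunk 06: cover** — for every listed `(i, m)` the row `rank3Rows06[i]` exists and its listed
span is `p`-saturated for every prime `7 < p ≤ m` (vacuous range; generic soundness of the selection
form). [cite: CremonaAlgorithms1997, §3.5] -/
theorem cover06 :
    ∀ e ∈ ([
      (44, 1), (64, 1), (76, 1), (79, 2), (84, 2), (89, 2), (150, 3), (168, 1), (182, 1), (295, 1),
      (335, 1)] : List (ℕ × ℕ)),
      ∃ r, rank3Rows06[e.1]? = some r ∧ ∀ p, p.Prime → 7 < p → p ≤ e.2 →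
        ∀ h : r.check = true, ∀ a : r.curve.toAffine.Point,
          p • a ∈ AddSubgroup.closure {r.gen₁ h, r.gen₂ h, r.gen₃ h} ⊔ AddCommGroup.torsion _ →
            a ∈ AddSubgroup.closure {r.gen₁ h, r.gen₂ h, r.gen₃ h} ⊔ AddCommGroup.torsion _ :=
  Rank3Row.pSaturated_of_pSatCheckKSel_idx (by rfl) pSatCheckK_06

/-- **GENERATORS under ONE named numeric hypothesis, chunk 06** (11 rows, register J11c
`m ≤ 10`; `m = 1` rows = LEVER S, saturation by exhaustive search): for every listed `(i, m)`, if
`rank3Rows06[i]` is a GRAND row and the index of its listed span is `≤ m` (instrument DATA, two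
implementations agree), then `E(ℚ) = ℤP₁ + ℤP₂ + ℤP₃ + E(ℚ)_tors`.
[cite: CremonaPrickettSiksek2006, Thm 1] [cite: CremonaAlgorithms1997, §3.5] -/
theorem generators06 :
    ∀ e ∈ ([
      (44, 1), (64, 1), (76, 1), (79, 2), (84, 2), (89, 2), (150, 3), (168, 1), (182, 1), (295, 1),
      (335, 1)] : List (ℕ × ℕ)),
      ∃ r, rank3Rows06[e.1]? = some r ∧ ∀ (hr : r ∈ rows) (h : r.check = true),
        (AddSubgroup.closure {r.gen₁ h, r.gen₂ h, r.gen₃ h} ⊔ AddCommGroup.torsion _).index ≤ e.2 →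
          AddSubgroup.closure {r.gen₁ h, r.gen₂ h, r.gen₃ h} ⊔ AddCommGroup.torsion _ = ⊤ := by
  intro e he
  obtain ⟨r, hr', H⟩ := cover06 e he
  refine ⟨r, hr', fun hr h hB => ?_⟩
  obtain ⟨hfi, h2, h3, h5, h7⟩ := PSatCensus357.index_coprime_210_of_mem_rows hr h
  haveI := hfi
  refine AddSubgroup.index_eq_one.mp
    (eq_one_of_forall_prime_le_not_dvd AddSubgroup.FiniteIndex.index_ne_zero hB fun p hp hpB => ?_)
  by_cases h7p : 7 < p
  · exact not_dvd_index_listedSpan hp (H p hp h7p hpB h)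
  · exact not_dvd_of_prime_le_seven h2 h3 h5 h7 hp h7p

/-- **Chunk 07, register J11c** (15 rows, two-implementation CPS-bound datum `m ≤ 10`): kernel check
of the selection `(position, m, [])` — every listed row exists in `rank3Rows07` and no prime
`7 < p ≤ m` is left uncertified (there is none). [cite: CremonaPrickettSiksek2006, Thm 1] -/
theorem pSatCheckK_07 :
    rank3PSatCheckKSel rank3Rows07 [
    (20, 1, []), (34, 3, []), (44, 1, []), (46, 3, []), (62, 1, []), (92, 4, []), (109, 1, []),
    (113, 1, []), (120, 2, []), (240, 1, []), (298, 8, []), (321, 1, []), (322, 3, []),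
    (328, 1, []), (351, 1, [])] = true := by
  decide +kernel

set_option maxRecDepth 8000 in
/-- **Chunk 07: cover** — for every listed `(i, m)` the row `rank3Rows07[i]` exists and its listed
span is `p`-saturated for every prime `7 < p ≤ m` (vacuous range; generic soundness of the selection
form). [cite: CremonaAlgorithms1997, §3.5] -/
theorem cover07 :
    ∀ e ∈ ([
      (20, 1), (34, 3), (44, 1), (46, 3), (62, 1), (92, 4), (109, 1), (113, 1), (120, 2), (240, 1),
      (298, 8), (321, 1), (322, 3), (328, 1), (351, 1)] : List (ℕ × ℕ)),
      ∃ r, rank3Rows07[e.1]? = some r ∧ ∀ p, p.Prime → 7 < p → p ≤ e.2 →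
        ∀ h : r.check = true, ∀ a : r.curve.toAffine.Point,
          p • a ∈ AddSubgroup.closure {r.gen₁ h, r.gen₂ h, r.gen₃ h} ⊔ AddCommGroup.torsion _ →
            a ∈ AddSubgroup.closure {r.gen₁ h, r.gen₂ h, r.gen₃ h} ⊔ AddCommGroup.torsion _ :=
  Rank3Row.pSaturated_of_pSatCheckKSel_idx (by rfl) pSatCheckK_07

/-- **GENERATORS under ONE named numeric hypothesis, chunk 07** (15 rows, register J11c
`m ≤ 10`; `m = 1` rows = LEVER S, saturation by exhaustive search): for every listed `(i, m)`, if
`rank3Rows07[i]` is a GRAND row and the index of its listed span is `≤ m` (instrument DATA, two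
implementations agree), then `E(ℚ) = ℤP₁ + ℤP₂ + ℤP₃ + E(ℚ)_tors`.
[cite: CremonaPrickettSiksek2006, Thm 1] [cite: CremonaAlgorithms1997, §3.5] -/
theorem generators07 :
    ∀ e ∈ ([
      (20, 1), (34, 3), (44, 1), (46, 3), (62, 1), (92, 4), (109, 1), (113, 1), (120, 2), (240, 1),
      (298, 8), (321, 1), (322, 3), (328, 1), (351, 1)] : List (ℕ × ℕ)),
      ∃ r, rank3Rows07[e.1]? = some r ∧ ∀ (hr : r ∈ rows) (h : r.check = true),
        (AddSubgroup.closure {r.gen₁ h, r.gen₂ h, r.gen₃ h} ⊔ AddCommGroup.torsion _).index ≤ e.2 →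
          AddSubgroup.closure {r.gen₁ h, r.gen₂ h, r.gen₃ h} ⊔ AddCommGroup.torsion _ = ⊤ := by
  intro e he
  obtain ⟨r, hr', H⟩ := cover07 e he
  refine ⟨r, hr', fun hr h hB => ?_⟩
  obtain ⟨hfi, h2, h3, h5, h7⟩ := PSatCensus357.index_coprime_210_of_mem_rows hr h
  haveI := hfi
  refine AddSubgroup.index_eq_one.mp
    (eq_one_of_forall_prime_le_not_dvd AddSubgroup.FiniteIndex.index_ne_zero hB fun p hp hpB => ?_)
  by_cases h7p : 7 < p
  · exact not_dvd_index_listedSpan hp (H p hp h7p hpB h)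
  · exact not_dvd_of_prime_le_seven h2 h3 h5 h7 hp h7p

end PSatCensusS10CPS

end Summit.BirchSwinnertonDyer.BirchSwinnertonDyer.Rank2Observatory
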